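import Summits.BirchSwinnertonDyer.Rank1Residual.F1Sign2.SignReciprocityAtTwo
import HarnessLib

/-!
# Cell `bsd-f1-sign2` — kernel bookkeeping for the -es MEMO-es §29 port (`F1Sign2/SignReciprocityAtTwo.lean`, ES-29)

THEOREMS ONLY (no `def`, no `sorry`, no named fact; ns `…Theorems.RankOneAtTwoSignReciprocity` as the statement file).  Contents: REF1 §191's BC7 / residue certificates from
`HOME/REF1-data/b191/lean/Probe191.lean` 80a9b1e83b986bc2 l.245–267 VERBATIM (ns `…F1Sign2.REF1s191` → this file's): `signFactor_cases` (the predicted factor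
`levelRaisedSignFactor W W' q ∈ {1, −1}`, so «= −1» in ES-29A/M/G/A♮ is a genuine dichotomy, never vacuous), `modTwoCongruent_refl` / `sendsMinToMin_refl` / `realTwistEven_refl`
(the identity congruence is archimedean-EVEN: sanity of the `∃ σ ∀ ι` shape; `SendsMinToMin` unfolds to ES-28's `SameRealKummerLine`), and the two `decide` certificates of the
(L-ord-i) residue route used in (T7) (good ordinary 2, `b₂` odd): `lordI_mod8` («`X ≡ −b₂ (mod 8)` ⟹ `F′(X) = 3X² + 2b₂X + 8b₄ ≡ 1 (mod 8)`») and `lordI_hensel` («`F(−b₂) ≡ 0 (mod 8)`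
and `F′(−b₂)² ≡ 1 (mod 8)`», the Hensel data for the `2`-torsion abscissa `X_° ∈ ℤ₂ˣ` reducing to `Õ`) — REF1-AUDIT §191 «REFEREE (T7) = (L-ord-i) + unique stable line + dictionary
algebra: PASS».  Typer -ty g18; std axioms on the farm.  BSD is not proved by this; no item closed; PARTITION none.
-/

noncomputable section

open scoped Classical

set_option linter.dupNamespace false
set_option autoImplicit false

namespace Summit.BirchSwinnertonDyer.BirchSwinnertonDyer.Theorems.RankOneAtTwoSignReciprocity

open Literature.NumberTheory.EllipticCurves WeierstrassCurve
open Summit.BirchSwinnertonDyer.BirchSwinnertonDyer.Theorems.RankOneAtTwoLevelRaising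
  (twoDivCubic ModTwoCongruent SameRealKummerLine MonodromyBitAtTwo)

/-! ## REF1 §191 certificates (`HOME/REF1-data/b191/lean/Probe191.lean` 80a9b1e83b986bc2, VERBATIM) -/

/-- BC7: the sign factor is a genuine sign (so `= -1` is a dichotomy, never vacuous). -/
theorem signFactor_cases (W W' : WeierstrassCurve ℚ) [W.IsGloballyMinimal] (q : ℕ) [Fact q.Prime] :
    levelRaisedSignFactor W W' q = 1 ∨ levelRaisedSignFactor W W' q = -1 := by
  unfold levelRaisedSignFactor
  by_cases hs : W'.HasSplitMultiplicativeReductionAtPrime q <;>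
    by_cases ht : (MonodromyBitAtTwo W' q ∧ ¬ TwoTorsionHalvableModQ W q) <;>
      by_cases hk : RealTwistEven W W' <;> simp [hs, ht, hk]

/-- BC7: the identity congruence is archimedean-even (sanity of the `∃ σ ∀ ι` shape). -/
theorem modTwoCongruent_refl (W : WeierstrassCurve ℚ) : ModTwoCongruent W W := ⟨AlgEquiv.refl⟩

/-- BC7: the identity congruence sends `e_min ↦ e_min` (`SendsMinToMin W W`, = ES-28's `SameRealKummerLine W W`). -/
theorem sendsMinToMin_refl (W : WeierstrassCurve ℚ) : SendsMinToMin W W :=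
  ⟨AlgEquiv.refl, fun _ => Iff.rfl⟩

/-- BC7: the identity congruence has an EVEN archimedean twist (`κ_∞(W,W) = 0`). -/
theorem realTwistEven_refl (W : WeierstrassCurve ℚ) : RealTwistEven W W := Or.inl (sendsMinToMin_refl W)

/-- (L-ord-i) residue certificate: `b₂` odd and `X ≡ -b₂ (mod 8)` force `F'(X) = 3X² + 2b₂X + 8b₄ ≡ 1 (mod 8)`. -/
theorem lordI_mod8 : ∀ b X c : ZMod 8, b * b = 1 → X = -b → 3 * X * X + 2 * b * X + 8 * c = 1 := by decide +kernel

/-- (L-ord-i) Hensel data: `F(-b₂) = -8 b₂ b₄ + 16 b₆ ≡ 0 (mod 8)` while `F'(-b₂)` is odd, for every odd `b₂`. -/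
theorem lordI_hensel : ∀ b c d : ZMod 8, b * b = 1 →
    ((-b) * (-b) * (-b) + b * ((-b) * (-b)) + 8 * c * (-b) + 16 * d = 0 ∧
      (3 * (-b) * (-b) + 2 * b * (-b) + 8 * c) * (3 * (-b) * (-b) + 2 * b * (-b) + 8 * c) = 1) := by decide +kernel

end Summit.BirchSwinnertonDyer.BirchSwinnertonDyer.Theorems.RankOneAtTwoSignReciprocity

end
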